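import Summits.ResolutionOfSingularities.ResolutionOfSingularities.Theorems.ConeCutLawB
import HarnessLib

/-!
# ConeCutRepeats — tree file 6/11: §B⁺ CONSECUTIVE REPEATS (a chart-switching double repeat is translated along
the old component)
and §B⁺⁺⁺ THE THIRD-REPEAT LAW part 1 (older-face vanishing `older_face_vanish`, slice cancellation).  PROVED.

Content VERBATIM from the decomp-res lens-3 g15 file `HOME/decomp-res-lens-3/g15/parts/ConeCut-rev5-f76e5309.lean`
(sha256 f76e53096babc227…; CRITIC-LEDGER
rows 102/105/110/123 CLEARED, landing orders 15:53:15Z / 17:40:15Z).  HOME = run/shared/lean/pub/decomp-res.  Host: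
route `MaxContactCut`, aside
31770 `DefectWalksDeep` (and 31870) through the tree's lens-3 g14 `Theorems/FloorCut{Classes,Floor}` + `MaxContactCutFloorCut`.

[WRITER NOTE (decomp-res writer g6): per the lens's own landing instruction its §0 (l.130–876 = g14 `FloorCut`
VERBATIM) is DELETED and the
tree's `…Theorems.FloorCut` opened instead; §C⁵ `section AxisLaw` (l.2949–3086) is the tree's
`Theorems/ConeCutAxisLaw` (landed earlier,
opened here); the restated ProximityCut letters `LeavesNewest` / `StaysOnNewest` / `leavesNewest_iff_not_stays` /
`NoFreePointTailsDeep`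
(byte-identical to `Theorems/ProximityCutClasses`) are deleted and opened from the tree; the three class definitions
`IsTameFrom`,
`NoMixedTailsDeep`, `NoTameMixedTailsDeep` live in the cone-free `Theorems/ConeCutClasses` (so the route can import
the co-owned MIXED
aside).  Split: ConeCutClasses · ConeCutLayers / ConeCutLayersPoint (§A state level) · ConeCutWalks (§B) ·
ConeCutLawB (§C) · ConeCutRepeats
(§B⁺, §B⁺⁺⁺ part 1) · ConeCutLawE (§B⁺⁺⁺ part 2, LAW E) · ConeCutZigzag (§B⁺⁺
Fibonacci/zigzag, LAW C) · ConeCutLaws (all-repeat rigidity,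
LAW I, §D booking) · MaxContactCutConeCut / MaxContactCutConeCutCells (§D wiring to 31770/31870 BY NAME, Theses
cone).  ONE namespace
`…Theorems.ConeCut` as in the lens; global `set_option` lines dropped; nothing else changed.]
(Sources: Hauser2010 §§D,F,G; HauserPerlega2019; Moh1987; CossartPiltant2019; CossartJannsenSaito2020 Thm. 2.14,
§§5,9; BenitoVillamayor2013 §7; CasasAlvero2000 Ch. 3; BierstoneGrigorievMilmanWlodarczyk2011 Def. 3.1.3.)
-/

noncomputable section

open MvPolynomial Finset
open Literature.AlgebraicGeometry.Resolution
open Literature.AlgebraicGeometry.Resolution.Hauser2010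
open Literature.AlgebraicGeometry.Resolution.PointBlowup
open Summit.ResolutionOfSingularities.ResolutionOfSingularities.Theorems.TightDefectClasses
open Summit.ResolutionOfSingularities.ResolutionOfSingularities.Theorems.TightDefectStrongWalks
open Summit.ResolutionOfSingularities.ResolutionOfSingularities.Theorems.ItineraryCutClasses
open Summit.ResolutionOfSingularities.ResolutionOfSingularities.Theorems.BoundaryLedger
open Literature.AlgebraicGeometry.Resolution.WeightedBlowup
open Literature.Barriers.ResolutionOfSingularities
open Summit.ResolutionOfSingularities.ResolutionOfSingularities.Theorems.FloorCut
open Summit.ResolutionOfSingularities.ResolutionOfSingularities.Theorems.ConeCutAxisLaw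
open Summit.ResolutionOfSingularities.ResolutionOfSingularities.Theorems.ProximityCut (NoOriginTails LeavesNewest StaysOnNewest)
open Summit.ResolutionOfSingularities.ResolutionOfSingularities.Theorems.ProximityCut (leavesNewest_iff_not_stays NoFreePointTailsDeep)
open Summit.ResolutionOfSingularities.ResolutionOfSingularities.Theorems.ExitLaw (fin3_cases)

namespace Summit.ResolutionOfSingularities.ResolutionOfSingularities.Theorems.ConeCut

/-! ## §B⁺ CONSECUTIVE REPEATS (g15 rev 1): a chart-switching double repeat is translated along the old component -/

section DoubleRepeat

variable {K : Type} [Field K] [DecidableEq K] {q : ℕ} {s₀ : State (Fin 3) K}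

omit [DecidableEq K] in
/-- `binExp_self`: Auxiliary step of this node's calculus, VERBATIM from the lens file (see the module docstring); the statement is its type. [folklore] -/
theorem binExp_self (i k : Fin 3) (n : ℕ) : binExp i k n n = Finsupp.single k n := by
  unfold binExp
  rw [Nat.sub_self, Finsupp.single_zero, zero_add]

omit [DecidableEq K] in
/-- The `u_k^n`-coefficient of the cone line `c·(u_k − β u_i)^n` is `c`. [folklore] -/
theorem coeff_cone_line {i k : Fin 3} (hki : k ≠ i) (c β : K) (n : ℕ) :
    coeff (Finsupp.single k n) (C c * (X k - C β * X i) ^ n) = c := by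
  classical
  have h : (X k - C β * X i : MvPolynomial (Fin 3) K) = X k + C (-β) * X i := by
    rw [map_neg, neg_mul, sub_eq_add_neg]
  rw [h, linear_pow_eq_sum, Finset.mul_sum, coeff_sum, Finset.sum_eq_single n]
  · rw [C_mul_monomial, coeff_monomial, binExp_self, if_pos rfl, Nat.choose_self, Nat.sub_self, pow_zero, mul_one,
      Nat.cast_one, mul_one]
  · intro a _ han
    rw [C_mul_monomial, coeff_monomial, if_neg]
    intro heq
    have h1 := DFunLike.congr_fun heq k
    rw [binExp_apply_k hki, Finsupp.single_eq_same] at h1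
    exact han h1
  · intro hn
    exact absurd (Finset.mem_range.mpr (Nat.lt_succ_self n)) hn

omit [DecidableEq K] in
/-- The `u_k^n`-coefficient of `c·u_j^n` vanishes (`k ≠ j`, `n ≥ 1`). [folklore] -/
theorem coeff_single_pow_X {j k : Fin 3} (hkj : k ≠ j) (c : K) {n : ℕ} (hn : 1 ≤ n) :
    coeff (Finsupp.single k n) (C c * (X j - C (0 : K) * X k) ^ n) = 0 := by
  classical
  rw [map_zero, zero_mul, sub_zero, X_pow_eq_monomial, C_mul_monomial, coeff_monomial, if_neg]
  intro h
  have h1 := DFunLike.congr_fun h k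
  rw [Finsupp.single_eq_same, Finsupp.single_eq_of_ne hkj] at h1
  omega

/-- **THE FACE TRANSPORT AT A REPEAT (PROVED)**: `coeff_{u_k^s} N_{t+1} = U_t(0) · coeff_{u_k^s} N_t` — the pure
`u_k`-coefficient of the residual form is carried through a proximity repeat up to the boundary unit. [new] [folklore] -/
theorem coeff_single_resForm_succ (hroot : IsRoot q s₀) (W : ForcedWalk q s₀) (t : ℕ) {o o' : ℕ}
    (ho : ordZero (W.st t).F = o) (ho' : ordZero (W.st (t + 1)).F = o') (hqo : q < o) (hqo' : q < o')
    (hplat : (W.st (t + 1)).shade = (W.st t).shade) (hplat' : (W.st (t + 2)).shade = (W.st (t + 1)).shade)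
    {n : ℕ} (hn : (W.st t).shade = (n : ℕ∞)) (hS : StaysOnNewest W t)
    {k : Fin 3} (hki : k ≠ W.j (t + 1)) (hkj : k ≠ W.j t) :
    coeff (Finsupp.single k n) (resForm W (t + 1) o') = bUnit W t * coeff (Finsupp.single k n) (resForm W t o) := by
  have h := coeff_resForm_of_repeat hroot W t ho ho' hqo hqo' hplat hplat' hn ⟨hS.1, hS.2⟩ hki hkj (le_refl n)
  rw [binExp_self, Nat.choose_self, Nat.sub_self, pow_zero, mul_one, Nat.cast_one, mul_one] at h
  exact h.symm

/-- **THE DOUBLE-REPEAT LAW (PROVED)**: three consecutive shade-preserving moves `t → t+1 → t+2 → t+3` from orders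
`> q` (shade `n ≥ 1`) with TWO proximity repeats (`StaysOnNewest W t`, `StaysOnNewest W (t+1)`) where the second
repeat switches to the THIRD chart (`j_{t+2} ≠ j_t`) force the second centre OFF the old component `E_{j_t}`:
`b_{t+2}(j_t) ≠ 0`.  (Power law twice + face transport: `N_t = c(u_k − βu_i)^n` has `u_k^n`-coefficient `c ≠ 0`,
carried to `N_{t+1}`; but `N_{t+1} = c'(u_{j_t} − β' u_k)^n` has `u_k^n`-coefficient `c'(−β')^n`.)  A NEW constraint on
g14's ledger automaton: the letter pair `S S` with a chart switch is a TRANSLATED move. [new] [folklore] -/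
theorem translated_of_double_repeat (hroot : IsRoot q s₀) (W : ForcedWalk q s₀) (t : ℕ) {o o' o'' : ℕ}
    (ho : ordZero (W.st t).F = o) (ho' : ordZero (W.st (t + 1)).F = o') (ho'' : ordZero (W.st (t + 2)).F = o'')
    (hqo : q < o) (hqo' : q < o') (hqo'' : q < o'')
    (hplat : (W.st (t + 1)).shade = (W.st t).shade) (hplat' : (W.st (t + 2)).shade = (W.st (t + 1)).shade)
    (hplat'' : (W.st (t + 3)).shade = (W.st (t + 2)).shade)
    {n : ℕ} (hn : (W.st t).shade = (n : ℕ∞)) (hn1 : 1 ≤ n) (hS : StaysOnNewest W t)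
    (hS' : StaysOnNewest W (t + 1)) (hk : W.j (t + 2) ≠ W.j t) : W.b (t + 2) (W.j t) ≠ 0 := by
  intro hβ
  -- indices: j := j_t, i := j_{t+1}, k := j_{t+2}
  have hki : W.j (t + 2) ≠ W.j (t + 1) := hS'.1
  have hn' : (W.st (t + 1)).shade = (n : ℕ∞) := hplat.trans hn
  -- power law at `t` (third index `k = j_{t+2}`): `u_k^n`-coefficient of `N_t` is `c ≠ 0`
  obtain ⟨c, hc, hNt⟩ := resForm_eq_pow_of_repeat hroot W t ho ho' hqo hqo' hplat hplat' hn ⟨hS.1, hS.2⟩ hki hk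
  have h1 : coeff (Finsupp.single (W.j (t + 2)) n) (resForm W t o) = c := by
    rw [hNt]; exact coeff_cone_line hki c _ n
  -- power law at `t+1` (third index `j_t`): `N_{t+1} = c'(u_{j_t} − β' u_k)^n` with `β' = b_{t+2}(j_t) = 0`
  obtain ⟨c', -, hNt1⟩ := resForm_eq_pow_of_repeat hroot W (t + 1) ho' ho'' hqo' hqo'' hplat' hplat'' hn'
    ⟨hS'.1, hS'.2⟩ hk.symm hS.1.symm
  have h2 : coeff (Finsupp.single (W.j (t + 2)) n) (resForm W (t + 1) o') = 0 := by
    rw [hNt1, hβ]; exact coeff_single_pow_X hk c' hn1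
  -- face transport
  have h3 := coeff_single_resForm_succ hroot W t ho ho' hqo hqo' hplat hplat' hn hS hki hk
  rw [h2, h1] at h3
  exact mul_ne_zero (bUnit_ne_zero W t) hc h3.symm

/-- **DOUBLE-REPEAT LAW, plateau form (PROVED)**: on a high plateau of shade `s ≥ 1`, two consecutive proximity repeats
whose second switches to the third chart have a translated second centre. [new] [folklore] -/
theorem translated_of_double_repeat_plateau (hroot : IsRoot q s₀) (W : ForcedWalk q s₀) {N s : ℕ} (hs : 1 ≤ s)
    (hplat : ∀ t, N ≤ t → (W.st t).shade = (s : ℕ∞) ∧ ((q : ℕ) : ℕ∞) < ordZero (W.st t).F)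
    {t : ℕ} (ht : N ≤ t) (hS : StaysOnNewest W t) (hS' : StaysOnNewest W (t + 1)) (hk : W.j (t + 2) ≠ W.j t) :
    W.b (t + 2) (W.j t) ≠ 0 := by
  obtain ⟨o, ho, -⟩ := walk_nat hroot W t
  obtain ⟨o', ho', -⟩ := walk_nat hroot W (t + 1)
  obtain ⟨o'', ho'', -⟩ := walk_nat hroot W (t + 2)
  have hlt : ∀ u, N ≤ u → ∀ {m : ℕ}, ordZero (W.st u).F = m → q < m := by
    intro u hu m hm
    have h := (hplat u hu).2
    rw [hm] at h
    exact_mod_cast h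
  have heq : ∀ u, N ≤ u → (W.st (u + 1)).shade = (W.st u).shade := fun u hu => by
    rw [(hplat (u + 1) (by omega)).1, (hplat u hu).1]
  exact translated_of_double_repeat hroot W t ho ho' ho'' (hlt t ht ho) (hlt (t + 1) (by omega) ho')
    (hlt (t + 2) (by omega) ho'') (heq t ht) (heq (t + 1) (by omega)) (heq (t + 2) (by omega)) (hplat t ht).1 hs
    hS hS' hk

end DoubleRepeat

/-! ## §B⁺⁺⁺ THE THIRD-REPEAT LAW (g15 rev 4, LAW E): a repeat preceded by two repeats is an UNTRANSLATED ZIGZAG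

The polynomial input beyond the cone law (§B) and the double-repeat law (§B⁺).  Two consecutive proximity repeats
`u → u+1 → u+2` on a plateau of shade `n ≥ 1` above `q` (`a = j_u`, `N = j_{u+1} ≠ a`, `k` the third index,
`β₁ = b_{u+1}(k)`) leave NO monomial `x^{r_{u+2}} · u_N^{n}` in `F_{u+2}` (**`older_face_vanish`**, the OLDER-FACE LAW):
that coefficient is read off the `a`-face of `F_{u+1}` (`coeff_pointTransform_layer`, nothing deleted there), which above
the boundary is `Φ = Bnd · c₁ (u_k − β₁ u_N)^n` (`coeff_step_layer` + `resForm_eq_pow_of_repeat`); for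
`β₁ = 0` the face
is `u_k^n`-divisible above `kept_u` and no term reaches the exponent, for `β₁ ≠ 0` the coefficient is the VALUE of a
homogeneous slice of `Φ` on the line `u_k = β₁ u_N` — a genuine cancellation (`layer_eval_eq_zero`), not termwise
vanishing.  Top-degree Taylor coefficients being translation invariant (`coeff_translate_top`), the `u_N^n`-coefficient
of the residual form `N_{u+2}` vanishes; at a THIRD repeat `u+2 → u+3` the power law makes this coefficient `c' ≠ 0`
(if `j_{u+3} ≠ N`) or `c'(−β₃)^n` (if `j_{u+3} = N`, `β₃` the free coordinate of `b_{u+3}`).  Hence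
**`j_{u+3} = N` and `b_{u+3} = 0`** (**`third_repeat`**): every repeat preceded by two repeats is an untranslated zigzag
step back to the penultimate chart.  COROLLARY (§D.4d, `noAllRepeatTails_holds`): an all-repeat tail is translation-free
from its third step on, so the all-repeat core `NoAllRepeatTailsDeep` — and with it the golden rigid core
`NoRigidAllRepeatTailsDeep` of rev 3 — is EMPTY for every `q = p^e` and every `s`; the high regime is RE-LOCATED at
`rigid free floors ∧ mixed words` (`highTwo_iff_free_mixed`). -/

section ThirdRepeat

variable {K : Type} [Field K] [DecidableEq K] {q : ℕ} {s₀ : State (Fin 3) K}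

/-- Two distinct indices of `Fin 3` leave a third. [folklore] -/
theorem exists_third {a c : Fin 3} (hac : a ≠ c) : ∃ k : Fin 3, k ≠ a ∧ k ≠ c := by
  revert a c
  decide

omit [DecidableEq K] in
/-- A product over `Fin 3` along three distinct indices. [folklore] -/
theorem prod_fin3 {a c k : Fin 3} (hac : a ≠ c) (hka : k ≠ a) (hkc : k ≠ c) (f : Fin 3 → K) :
    ∏ i, f i = f a * f c * f k := by
  have huniv : (Finset.univ : Finset (Fin 3)) = {a, c, k} := by
    ext l
    simp only [Finset.mem_univ, Finset.mem_insert, Finset.mem_singleton, true_iff]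
    exact fin3_cases hac hka hkc l
  have h1 : a ∉ ({c, k} : Finset (Fin 3)) := by
    simp only [Finset.mem_insert, Finset.mem_singleton, not_or]
    exact ⟨hac, fun h => hka h.symm⟩
  have h2 : c ∉ ({k} : Finset (Fin 3)) := by
    rw [Finset.mem_singleton]
    exact fun h => hkc h.symm
  rw [huniv, Finset.prod_insert h1, Finset.prod_insert h2, Finset.prod_singleton, mul_assoc]

omit [DecidableEq K] in
/-- The `u_i^n`-coefficient of the cone line `c · (u_k − β u_i)^n` is `c (−β)^n`. [folklore] -/
theorem coeff_cone_line_far {i k : Fin 3} (hki : k ≠ i) (c β : K) (n : ℕ) :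
    coeff (Finsupp.single i n) (C c * (X k - C β * X i) ^ n) = c * (-β) ^ n := by
  classical
  have h : (X k - C β * X i : MvPolynomial (Fin 3) K) = X k + C (-β) * X i := by
    rw [map_neg, neg_mul, sub_eq_add_neg]
  have h0 : binExp i k n 0 = Finsupp.single i n := by
    unfold binExp
    rw [Nat.sub_zero, Finsupp.single_zero, add_zero]
  rw [h, linear_pow_eq_sum, Finset.mul_sum, coeff_sum, Finset.sum_eq_single 0]
  · rw [C_mul_monomial, coeff_monomial, if_pos h0]
    simp only [Nat.choose_zero_right, Nat.cast_one, one_mul, Nat.sub_zero]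
  · intro a _ ha0
    rw [C_mul_monomial, coeff_monomial, if_neg]
    intro heq
    have h1 := DFunLike.congr_fun heq k
    rw [binExp_apply_k hki, Finsupp.single_eq_of_ne hki] at h1
    exact ha0 h1
  · intro h0'
    exact absurd (Finset.mem_range.mpr (Nat.zero_lt_succ n)) h0'

omit [DecidableEq K] in
/-- **Top-degree Taylor coefficients are translation invariant**: if every exponent of `P` has degree `≤ |E|` then
`coeff_E P(u + b) = coeff_E P(u)`. [folklore] -/
theorem coeff_translate_top (b : Fin 3 → K) (P : MvPolynomial (Fin 3) K) {E : Fin 3 →₀ ℕ}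
    (hP : ∀ d ∈ P.support, d.degree ≤ E.degree) : coeff E (translate b P) = coeff E P := by
  classical
  have aux : ∀ d ∈ P.support, d ≠ E → coeff E (translate b (monomial d (coeff d P))) = 0 := by
    intro d hd hne
    by_contra hne0
    have hle : E ≤ d := Finsupp.le_def.mpr fun i => by
      by_contra hlt
      exact hne0 (coeff_translate_monomial_eq_zero_of_lt b d E _ (not_le.mp hlt))
    exact hne (finsupp_eq_of_le_of_degree_le hle (hP d hd)).symm
  conv_lhs => rw [P.as_sum, translate_finset_sum, coeff_sum]
  by_cases hE : E ∈ P.support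
  · rw [Finset.sum_eq_single E (fun d hd hne => aux d hd hne) (fun h => absurd hE h),
      coeff_translate_monomial_self]
  · rw [Finset.sum_eq_zero (fun d hd => aux d hd (fun h => hE (h ▸ hd))), MvPolynomial.notMem_support_iff.mp hE]

omit [DecidableEq K] in
/-- **A cone factor kills every homogeneous slice on its apex line**: for `P = Bnd · c (u_k − β u_N)^n`, `n ≥ 1`, and a
point with `pt_k = β · pt_N`:  `Σ_{|e| = m} coeff_e P · pt^e = 0`. [folklore] -/
theorem layer_eval_eq_zero (Bnd : MvPolynomial (Fin 3) K) {N k : Fin 3} (c β : K) {n : ℕ} (hn : 1 ≤ n)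
    (pt : Fin 3 → K) (hpt : pt k = β * pt N) (m : ℕ) :
    ∑ e ∈ (Bnd * (C c * (X k - C β * X N) ^ n)).support with e.degree = m,
      coeff e (Bnd * (C c * (X k - C β * X N) ^ n)) * ∏ i, pt i ^ e i = 0 := by
  classical
  set H : MvPolynomial (Fin 3) K := C c * (X k - C β * X N) ^ n with hH
  have hHh : H.IsHomogeneous n := by
    have h1 : (X k - C β * X N : MvPolynomial (Fin 3) K).IsHomogeneous 1 :=
      (isHomogeneous_X _ _).sub ((isHomogeneous_X _ _).C_mul β)
    have h2 := (h1.pow n).C_mul c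
    rwa [one_mul] at h2
  have hH0 : eval pt H = 0 := by
    rw [hH, map_mul, map_pow, map_sub, map_mul, eval_C, eval_C, eval_X, eval_X, hpt, sub_self,
      zero_pow (by omega), mul_zero]
  have hsum : (∑ e ∈ (Bnd * H).support with e.degree = m, coeff e (Bnd * H) * ∏ i, pt i ^ e i) =
      eval pt (homogeneousComponent m (Bnd * H)) := by
    rw [homogeneousComponent_apply, map_sum]
    refine Finset.sum_congr rfl fun e _ => ?_
    rw [eval_monomial, Finsupp.prod_fintype _ _ (fun i => pow_zero _)]
  rw [hsum, ← sum_homogeneousComponent Bnd, Finset.sum_mul, map_sum, map_sum]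
  refine Finset.sum_eq_zero fun i _ => ?_
  have hmem : homogeneousComponent i Bnd * H ∈ homogeneousSubmodule (Fin 3) K (i + n) :=
    (mem_homogeneousSubmodule _ _).mpr ((homogeneousComponent_isHomogeneous i Bnd).mul hHh)
  rw [homogeneousComponent_of_mem hmem]
  split_ifs
  · rw [map_mul, hH0, mul_zero]
  · exact map_zero _

/-- **LAW E core — the third repeat from the older face (PROVED).**  If move `u+1` was a proximity repeat
(`j_{u+2} ≠ N = j_{u+1}`, `b_{u+2}(N) = 0`), moves `u+2 → u+3 → u+4` are plateau steps from orders `> q` of shade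
`n ≥ 1`, move `u+3` is a repeat again, and `F_{u+2}` has no monomial `x^{r_{u+2}} u_N^n` (the older-face law), then
`b_{u+3} = 0` and `j_{u+3} = N`: the `u_N^n`-coefficient of the residual form `N_{u+2}` is that face coefficient
(`coeff_translate_top`, `coeff_resLayer`), and by the power law at the repeat `u+3` it equals `c' ≠ 0` if `j_{u+3} ≠ N`
(`coeff_cone_line`) and `c'(−β₃)^n` if `j_{u+3} = N` (`coeff_cone_line_far`). [new] [folklore] -/
theorem third_repeat_of_face (hroot : IsRoot q s₀) (W : ForcedWalk q s₀) (u : ℕ) {o₂ o₃ : ℕ}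
    (ho₂ : ordZero (W.st (u + 2)).F = o₂) (ho₃ : ordZero (W.st (u + 3)).F = o₃) (hqo₂ : q < o₂) (hqo₃ : q < o₃)
    (hplat₂ : (W.st (u + 3)).shade = (W.st (u + 2)).shade) (hplat₃ : (W.st (u + 4)).shade = (W.st (u + 3)).shade)
    {n : ℕ} (hn : (W.st (u + 2)).shade = (n : ℕ∞)) (hn1 : 1 ≤ n)
    (hS₁ : StaysOnNewest W (u + 1)) (hS₂ : StaysOnNewest W (u + 2))
    (hface : coeff ((W.st (u + 2)).r + Finsupp.single (W.j (u + 1)) n) (W.st (u + 2)).F = 0) :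
    W.b (u + 3) = 0 ∧ W.j (u + 3) = W.j (u + 1) := by
  classical
  have h2N : W.j (u + 2) ≠ W.j (u + 1) := hS₁.1
  have hr := walk_r hroot W (u + 2)
  obtain ⟨n', hn', hon⟩ := order_eq_shade_add_degree hroot W (u + 2) ho₂
  have hnn : n' = n := by have h := hn'.symm.trans hn; exact_mod_cast h
  rw [hnn] at hon
  -- the `u_N^n`-coefficient of the residual form of move `u+2` is the (vanishing) older-face coefficient
  have hupd : (Finsupp.single (W.j (u + 1)) n : Fin 3 →₀ ℕ).update (W.j (u + 2)) 0 =
      Finsupp.single (W.j (u + 1)) n := by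
    ext l
    rw [update_apply']
    split_ifs with hl
    · rw [hl, Finsupp.single_eq_of_ne h2N]
    · rfl
  have hlay : coeff (Finsupp.single (W.j (u + 1)) n) (resLayer (W.j (u + 2)) (W.st (u + 2)) o₂) = 0 := by
    rw [← hupd, coeff_resLayer (W.j (u + 2)) (W.st (u + 2)) hr o₂ (Finsupp.single (W.j (u + 1)) n)
      (by rw [Finsupp.degree_single]; omega)]
    exact hface
  have hcoef : coeff (Finsupp.single (W.j (u + 1)) n) (resForm W (u + 2) o₂) = 0 := by
    unfold resForm
    rw [coeff_translate_top]
    · exact hlay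
    · intro d hd
      rw [Finsupp.degree_single]
      have := degree_le_of_coeff_resLayer_ne_zero (W.j (u + 2)) (W.st (u + 2)) hr o₂
        (MvPolynomial.mem_support_iff.mp hd)
      omega
  -- power law at the third repeat `u+2 → u+3`
  by_cases hj₃ : W.j (u + 3) = W.j (u + 1)
  · obtain ⟨m, hmN, hm2⟩ := exists_third h2N.symm
    have hm3 : m ≠ W.j (u + 3) := by rw [hj₃]; exact hmN
    obtain ⟨c, hc, hR⟩ := resForm_eq_pow_of_repeat hroot W (u + 2) ho₂ ho₃ hqo₂ hqo₃ hplat₂ hplat₃ hn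
      ⟨hS₂.1, hS₂.2⟩ hm3 hm2
    rw [hR, hj₃, coeff_cone_line_far hmN] at hcoef
    have hβ : W.b (u + 3) m = 0 := by
      have h := (mul_eq_zero.mp hcoef).resolve_left hc
      exact neg_eq_zero.mp ((pow_eq_zero_iff (by omega)).mp h)
    refine ⟨?_, hj₃⟩
    funext l
    show W.b (u + 3) l = 0
    rcases fin3_cases h2N.symm hmN hm2 l with hl | hl | hl
    · rw [hl, ← hj₃]; exact W.onExc (u + 3)
    · rw [hl]; exact hS₂.2
    · rw [hl]; exact hβ
  · exfalso
    have hN3 : W.j (u + 1) ≠ W.j (u + 3) := fun h => hj₃ h.symm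
    obtain ⟨c, hc, hR⟩ := resForm_eq_pow_of_repeat hroot W (u + 2) ho₂ ho₃ hqo₂ hqo₃ hplat₂ hplat₃ hn
      ⟨hS₂.1, hS₂.2⟩ hN3 h2N.symm
    rw [hR, coeff_cone_line hN3] at hcoef
    exact hc hcoef

end ThirdRepeat

end Summit.ResolutionOfSingularities.ResolutionOfSingularities.Theorems.ConeCut
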